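import Summits.QuantumFields.BalabanUV.Beta.SymWardLettersAn1
import Summits.QuantumFields.BalabanUV.Beta.GAN24.SymHessianGaugeLegContact
import Summits.QuantumFields.BalabanUV.Beta.GAN24.SymLinKernelBlockMoments
import Summits.QuantumFields.BalabanUV.Beta.GAN24.WardResidualRotatedVertex

/-!
# `BalabanUV.Beta.GAN24.SymRMChargeFree` — binder row G-an2-4 ∕ (CONV-C), CT-W route «WC-TL» ∕ (Q-R) «QR-LL», the (S) row of RULING R-gan24p1-g27-1,
# piece **(S-β): an1's MIXED WARD REMAINDER `symRMAn1 Lc cΛ` IS CHARGE-FREE PER LETTER** (every level `j`, every label `y`, every multiplier leg `(ρ′, w)`,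
# every channel `(a, b)`; centred root, `Lc` odd, Λ-lock `cΛ·Lc⁴ = 2`) — the OWNER gan24-p1 g27's R14 (5) ∕ R15 (x) «(S-β) = the an1-COUNT identity per
# letter» AS A THEOREM, and the consequence for the Ward-locus residual tower: THE (β)-PIECE `vertexOfM G Lc (symRMAn1 Lc cΛ j y) ν y′` OF THE LEVEL-(j+1)
# FIRST-ORDER DATA HAS IDENTICALLY VANISHING PLAIN CHARGE PROFILE (G-an2-4 formalisation swarm → CRUX TEAM (2), seat `b2b-balaban-gan24-formalise-leaf-02`, gen 55)

NOT IN PRINT; OUR BOOKKEEPING ([folklore] finite-sum algebra over an1's typed objects and laws BY NAME — `SymMixedWardPacking` (`symWardM ∕ symDatM ∕ symRWof`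
and their entries), `SymMixedWardSiteLaw.symSiteWardM` (the SITE Ward law (W2-M)_sym, every `Lc ≠ 0`), `SymWardLettersAn1.symRMAn1 ∕ vertexFamily_symRMAn1`,
`SymAveragingHessianCounts` (support of `symHessKerAt`), `SymSliceProjectorDiagComm.sum_box_legInd_inl`; this seat's `GAN24.SymHessianGaugeLegContact`
(`dψ`-laws, gen 47) and `GAN24.SymLinKernelExpansion ∕ SymLinKernelBlockMoments` (PART 1a∕1b, gen 55); p2's value form `WardResidualRotatedVertex.hasSum_prod_vertexOfM`;
0 `def`, 0 cited fact, 0 `def … : Prop`, 0 sorry).  HONEST FRAMING (cell contract, verbatim): «discharging `BetaPertH` makes Bałaban's UV stability UNCONDITIONAL — a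
real constructive-QFT result; it is NOT the continuum limit and NOT the Clay problem.»  HONEST DEPENDENCY (verbatim): «continuum YM on T⁴ ⇐ BetaPertH ∧ nine spine
estimates (0/9 proved); BetaPertH ⇐ (D1) ∧ (D4) ∧ CAP+tail; G-an2-4 gates asym, D1 and NE2/3/4.»

WHERE THIS SITS.  In the S-step form of the Ward-locus residual tower (`WardResidualSRecursion.divW_WrecAt_succ_vertexForm`, binder `hM₂` supplied by an1's
`SymWardLettersAn1.hM₂_sym` with `RM := symRMAn1 Lc cΛ`) the level-(j+1) first-order data are `Ψ′ y ν y′ = vertexOfM G_{j+1} Lc (symRMAn1 Lc cΛ j y) ν y′ + (α) + (γ)`.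
The OWNER's (S) row asks, per label and channel, zero mass and zero first slot-moments of the plain charge profile `(ν,y′) ↦ Σ'_{(x,z)} Ψ′ y ν y′ x z a b`
(leaf-01's `LayerFrozenCount ∕ LayerTransportLedger` consume them as `hM0 ∕ hP1`); his engine E18 (kit j154879, D = 2: 162∕162 letters; E20, D = 3: 81∕81) found
the (β)-letters charge-free ONE BY ONE.  This file proves it: for the (β)-piece no symmetry ((INV)) and no W-Z0 are needed — its profile is identically zero.
* §1 ENTRIES: `sum_box_ite_eq_blk ∕ '`, **`symWardM_inl_inl_eq`** (the block sum of an1's SITE law: `(2∕Lc⁴)·h·(𝟙[w=y] − 𝟙[blk x = y])`), **`symRWof_inl_inl_eq`**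
  (general `cΛ`), **`symRWof_inl_inl_lock`** (`= cΛ·h·(𝟙[w=y] − ½𝟙[blk x = y] − ½𝟙[blk x′ = y])` at the lock — leaf-02 g54's (4.8) weights).
* §2 ROW ∕ COLUMN SUMS: `tsum_symHessKerAt_row ∕ _col` — the `dψ`-laws with `ψ` a coordinate: `Σ'_{x′} h((β,x),(β′,x′)) = −W_{β′}(β,x)·q¹(β,x)∕2`,
  `Σ'_x h((β,x),(β′,x′)) = W_β(β′,x′)·q¹(β′,x′)∕2`.
* §3 THE CHARGE: **`tsum_prod_symRWof_inl_inl`** (`Lc` odd, lock): `Σ'_{(x,x′)} symRWof … x x′ (inl β) (inl β′) = 0` — diagonal channels by PART 1a's exactness,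
  off-diagonal by PART 1b's block reflection; `tsum_prod_symRWof` (all fibre indices), **`tsum_prod_symRMAn1_eq_zero`** (every level), `hasSum_prod_symRMAn1`.
* §4 THE (β)-PIECE: **`hasSum_prod_vertexOfM_symRMAn1`** ∕ `tsum_prod_vertexOfM_symRMAn1` — through ANY kernel `G` with decaying multiplier columns,
  `HasSum ((x,z) ↦ vertexOfM G Lc (symRMAn1 Lc cΛ j y) ν y′ x z a b) 0`: the plain charge profile of the (β)-piece is the zero function of the slot;
  **`hasSum_prod_vertexOfM_symRMAn1_comb`** — the tower's own `G = coDressKBmAt ρ_c Lc (KInvStep Lc j′)`, HYPOTHESIS-FREE (an2's `decays_coDressKBmAt_KInvStep`).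
CURRENCY (located, honest): this is (S-β) in the PLAIN pair-charge currency — the (S) row's currency per RULING R-gan24p1-g27-1 A1 ∕ leaf-01 g64 W-1 (the entry
estimate eats the plain profile of each level's letter; the transport to the next level is the (S-τ) push lemma's business, leaf-01 `Push3Relabel`).  Against
GENERAL block-periodic two-leg weights `p(x mod Lc, a)·p′(x′ mod Lc, b)` the β-letter charge does NOT vanish (exact-rational numerics on the definitions, seat folder
`g55/num/sbeta_periodic.py`: O(1) values at D = 2, 3) — the `dψ`-argument needs one CONSTANT slot; so a weighted ∕ transported twin of §3 is NOT claimed here: it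
would need structure of the transporting kernel's leg weights (ONE sufficient mechanism: block-constant weights on field legs, which reduce it to §3), not a property of
`symRMAn1` alone; which mechanism the OWNER's E18 «transported ≤ 1.1e-13 per letter» reflects is NOT located here ((S-τ), leaf-01's push lemma, carries (S-β) upward).
HONEST: discharges (S-β) ONLY (plain currency) — the (β)-piece drops out of the (S) row; (INV) for (α)+(γ), W-Z0, (S-τ) and everything of (Q-R) ∕ (LT) ∕ (Q-L) ∕ (C) ∕
«T2Shape» ∕ «T2Drift» ∕ (hW, hWall) remain; off the Λ-lock the DIAGONAL channels are NOT charge-free (PART 1b's numerics note).  NEVER «G-an2-4 closed» as (CONV-C);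
NOT D1, NOT `BetaPertH`, NOT continuum, NOT Clay.  2026-08-22; no existing file touched.
-/

noncomputable section

open Finset
open scoped BigOperators
open Literature.MathematicalPhysics.QuantumFieldTheory
open Literature.MathematicalPhysics.QuantumFieldTheory.Balaban1983to89
open Literature.MathematicalPhysics.QuantumFieldTheory.Balaban1983to89.Beta
open B12Sec2to5 (l1)
open ExpKernelCalculus (Site MKer VertexFamily)
open AffineAveraging (box toSite unitVec unitVec_apply dz)
open AveragingContours (blk blk_block)
open AveragingContoursRooted (ctr ctrOff ctr_apply ctrOff_mem_box)
open AveragingHessianKernels (Near)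
open OneStepResolventKernel (Fib)
open OneStepKernelFamily (KInvStep)
open SecondOrderResponse (colM vertexOfM abs_colM_le)
open Summit.QuantumFields.BalabanUV.Beta.AveragingWardRootedStencils (legInd legInd_inl)
open Summit.QuantumFields.BalabanUV.Beta.SymSliceProjectorDiagComm (sum_box_legInd_inl)
open Summit.QuantumFields.BalabanUV.Beta.AxialDressingRooted (one_le_of_neZero coDressKBmAt decays_coDressKBmAt_KInvStep)
open Summit.QuantumFields.BalabanUV.Beta.SymAveragingHessianCounts (symHessFFAt symHessKerAt symLinKerAt symHessFFAt_inl_inl symHessKerAt_eq_zero_left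
  symHessKerAt_eq_zero_right)
open Summit.QuantumFields.BalabanUV.Beta.SymMixedWardPacking (symWardM symDatM symRWof symWardM_inl_inl symWardM_inl_inr symWardM_inr symDatM_inl_inl
  symDatM_inl_inr symDatM_inr symRWof_apply)
open Summit.QuantumFields.BalabanUV.Beta.SymMixedWardSiteLaw (symSiteWardM)
open Summit.QuantumFields.BalabanUV.Beta.SymWardLettersAn1 (symRMAn1 vertexFamily_symRMAn1)
open Summit.QuantumFields.BalabanUV.Beta.LinearGaugeVH (nearBox mem_nearBox summable_of_finsupp)
open Summit.QuantumFields.BalabanUV.Beta.GAN24.SymHessianGaugeLegContact (tsum_dz_mul_symHessFFAt tsum_symHessFFAt_mul_dz)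
open Summit.QuantumFields.BalabanUV.Beta.GAN24.SymLinKernelExpansion (tsum_coordWeight_mul_symLinKerAt_diag symLinKerAt_eq_zero_of_not_mem)
open Summit.QuantumFields.BalabanUV.Beta.GAN24.SymLinKernelBlockMoments (tsum_coordWeight_mul_symLinKerAt_eq_zero tsum_blk_coordWeight_mul_symLinKerAt_eq_zero)
open Summit.QuantumFields.BalabanUV.Beta.GAN24.WardResidualRotatedVertex (hasSum_prod_vertexOfM)

namespace Summit.QuantumFields.BalabanUV.Beta.GAN24.SymRMChargeFree

variable {Lc : ℕ} [NeZero Lc]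

/-! ## §1 The field–field entries of `symWardM`, `symRWof` in closed form: block indicators times an1's symmetrised constraint Hessian -/

/-- [folklore] THE BLOCK INDICATOR: `Σ_{v ∈ box} [z = Lc•y + v] = [blk Lc z = y]` (an1's `sum_box_legInd_inl` on a field leg). -/
theorem sum_box_ite_eq_blk (y z : Fin (3 + 1) → ℤ) :
    (∑ v ∈ box (3 + 1) Lc, (if z = (Lc : ℤ) • y + toSite v then (1 : ℝ) else 0)) = if blk Lc z = y then 1 else 0 := by
  have h := sum_box_legInd_inl (one_le_of_neZero Lc) (ctr 4 Lc) y z (0 : Fin (3 + 1))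
  simpa only [legInd_inl] using h

/-- [folklore] The block indicator, the other orientation of the test: `Σ_{v ∈ box} [Lc•y + v = z] = [blk Lc z = y]`. -/
theorem sum_box_ite_eq_blk' (y z : Fin (3 + 1) → ℤ) :
    (∑ v ∈ box (3 + 1) Lc, (if (Lc : ℤ) • y + toSite v = z then (1 : ℝ) else 0)) = if blk Lc z = y then 1 else 0 := by
  rw [← sum_box_ite_eq_blk y z]
  refine Finset.sum_congr rfl fun v _ => ?_
  by_cases h : (Lc : ℤ) • y + toSite v = z
  · rw [if_pos h, if_pos h.symm]
  · rw [if_neg h, if_neg fun h' => h h'.symm]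

/-- NOT IN PRINT; OUR BOOKKEEPING.  **THE FIELD–FIELD ENTRIES OF `symWardM` IN CLOSED FORM** — the block sum of an1's SITE Ward law (W2-M)_sym
(`SymMixedWardSiteLaw.symSiteWardM`, every `Lc ≠ 0`): `symWardM Lc y ρ′ w x x′ (inl β) (inl β′) = Lc⁻⁴ · 2·h_sym,(ρ′,w)((β,x),(β′,x′)) · (𝟙[w = y] − 𝟙[blk Lc x = y])`
— the background-leg divergence of the mixed table, summed over the block `B(y)`, sees only whether the ROOT and the FIRST FLUCTUATION SITE lie in `B(y)`. -/
theorem symWardM_inl_inl_eq (y : Fin (3 + 1) → ℤ) (ρ' : Fin (3 + 1)) (w x x' : Fin (3 + 1) → ℤ) (β β' : Fin (3 + 1)) :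
    symWardM Lc y ρ' w x x' (Sum.inl β) (Sum.inl β')
      = ((Lc : ℝ) ^ (3 + 1))⁻¹ * (2 * symHessKerAt (ctr 4 Lc) Lc ρ' w (β, x) (β', x')
          * ((if w = y then (1 : ℝ) else 0) - (if blk Lc x = y then (1 : ℝ) else 0))) := by
  rw [symWardM_inl_inl]
  simp only [symSiteWardM]
  rw [← Finset.mul_sum, Finset.sum_sub_distrib]
  congr 2
  have hb : blk Lc ((Lc : ℤ) • w + ctr 4 Lc) = w := blk_block w (ctrOff_mem_box (one_le_of_neZero Lc))
  rw [sum_box_ite_eq_blk', sum_box_ite_eq_blk', hb]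

/-- NOT IN PRINT; OUR BOOKKEEPING.  **THE FIELD–FIELD ENTRIES OF THE RESIDUAL `symRWof` IN CLOSED FORM, EVERY `cΛ`**:
`h · ((2∕Lc⁴)·(𝟙[w=y] − 𝟙[blk x = y]) − cΛ·(½𝟙[blk x′ = y] − ½𝟙[blk x = y]))`. -/
theorem symRWof_inl_inl_eq (cΛ : ℝ) (y : Fin (3 + 1) → ℤ) (ρ' : Fin (3 + 1)) (w x x' : Fin (3 + 1) → ℤ) (β β' : Fin (3 + 1)) :
    symRWof Lc cΛ y ρ' w x x' (Sum.inl β) (Sum.inl β')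
      = symHessKerAt (ctr 4 Lc) Lc ρ' w (β, x) (β', x')
        * ((2 / (Lc : ℝ) ^ (3 + 1)) * ((if w = y then (1 : ℝ) else 0) - (if blk Lc x = y then (1 : ℝ) else 0))
            - cΛ * ((1 / 2 : ℝ) * (if blk Lc x' = y then (1 : ℝ) else 0) - (1 / 2 : ℝ) * (if blk Lc x = y then (1 : ℝ) else 0))) := by
  rw [symRWof_apply, symWardM_inl_inl_eq, symDatM_inl_inl, sum_box_ite_eq_blk, sum_box_ite_eq_blk]
  ring

/-- NOT IN PRINT; OUR BOOKKEEPING.  **AT THE Λ-LOCK `cΛ·Lc⁴ = 2`**: `symRWof Lc cΛ y ρ′ w x x′ (inl β) (inl β′) = cΛ · h((β,x),(β′,x′)) · (𝟙[w=y] − ½𝟙[blk x = y] − ½𝟙[blk x′ = y])`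
(leaf-02 g54's located (4.8) weights, now two lines from an1's laws). -/
theorem symRWof_inl_inl_lock {cΛ : ℝ} (hΛ : cΛ * (Lc : ℝ) ^ 4 = 2) (y : Fin (3 + 1) → ℤ) (ρ' : Fin (3 + 1)) (w x x' : Fin (3 + 1) → ℤ)
    (β β' : Fin (3 + 1)) :
    symRWof Lc cΛ y ρ' w x x' (Sum.inl β) (Sum.inl β')
      = cΛ * symHessKerAt (ctr 4 Lc) Lc ρ' w (β, x) (β', x')
        * ((if w = y then (1 : ℝ) else 0) - (1 / 2 : ℝ) * (if blk Lc x = y then (1 : ℝ) else 0) - (1 / 2 : ℝ) * (if blk Lc x' = y then (1 : ℝ) else 0)) := by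
  have hL : (Lc : ℝ) ≠ 0 := by exact_mod_cast NeZero.ne Lc
  have hL4 : (Lc : ℝ) ^ (3 + 1) ≠ 0 := pow_ne_zero _ hL
  have hc : 2 / (Lc : ℝ) ^ (3 + 1) = cΛ := by
    rw [div_eq_iff hL4, ← hΛ]
  rw [symRWof_inl_inl_eq, hc]
  ring

/-! ## §2 Row and column sums of an1's symmetrised constraint Hessian: the `dψ`-laws with `ψ` a coordinate function -/

/-- [folklore] The coordinate function `ψ_λ(z) = z_λ` has `dz ψ_λ α z = [α = λ]`. -/
theorem dz_coord (lam α : Fin (3 + 1)) (z : Fin (3 + 1) → ℤ) :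
    dz (fun z : Fin (3 + 1) → ℤ => ((z lam : ℤ) : ℝ)) α z = if α = lam then (1 : ℝ) else 0 := by
  rcases eq_or_ne α lam with h | h
  · subst h; simp [AffineAveraging.dz]
  · simp [AffineAveraging.dz, h, Ne.symm h]

/-- NOT IN PRINT; OUR BOOKKEEPING.  **ROW SUM** (second-slot `dψ`-law of `GAN24.SymHessianGaugeLegContact`, `ψ := z ↦ z_{β′}`):
`Σ'_{x′} h_sym,(ρ′,w)((β,x),(β′,x′)) = −(x_{β′} + (x+e_β)_{β′} − r_{β′} − (r + Lc•e_{ρ′})_{β′}) · q¹_sym,(ρ′,w)(β,x) ∕ 2`, `r = Lc•w + ρ_c`. -/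
theorem tsum_symHessKerAt_row (ρ' : Fin (3 + 1)) (w x : Fin (3 + 1) → ℤ) (β β' : Fin (3 + 1)) :
    ∑' x', symHessKerAt (ctr 4 Lc) Lc ρ' w (β, x) (β', x')
      = -((((x β' : ℤ) : ℝ) + (((x + unitVec β) β' : ℤ) : ℝ) - ((((Lc : ℤ) • w + ctr 4 Lc) β' : ℤ) : ℝ)
          - ((((Lc : ℤ) • w + ctr 4 Lc + (Lc : ℤ) • unitVec ρ') β' : ℤ) : ℝ)) * symLinKerAt (ctr 4 Lc) Lc ρ' w (β, x) / 2) := by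
  have h := tsum_symHessFFAt_mul_dz (one_le_of_neZero Lc) (ctrOff_mem_box (one_le_of_neZero Lc)) ρ' w x β
    (fun z : Fin (3 + 1) → ℤ => ((z β' : ℤ) : ℝ))
  have hpt : ∀ x' : Fin (3 + 1) → ℤ,
      ∑ α', symHessFFAt (toSite (ctrOff (3 + 1) Lc)) Lc ρ' w x x' (Sum.inl β) (Sum.inl α') * dz (fun z : Fin (3 + 1) → ℤ => ((z β' : ℤ) : ℝ)) α' x'
        = symHessKerAt (ctr 4 Lc) Lc ρ' w (β, x) (β', x') := by
    intro x'
    rw [Finset.sum_eq_single β']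
    · rw [dz_coord, if_pos rfl, mul_one, symHessFFAt_inl_inl]; rfl
    · intro α' _ hα'
      rw [dz_coord, if_neg hα', mul_zero]
    · exact fun h => absurd (Finset.mem_univ β') h
  simp only [hpt] at h
  rw [h]
  rfl

/-- NOT IN PRINT; OUR BOOKKEEPING.  **COLUMN SUM** (first-slot `dψ`-law, `ψ := z ↦ z_β`):
`Σ'_x h_sym,(ρ′,w)((β,x),(β′,x′)) = (x′_β + (x′+e_{β′})_β − r_β − (r + Lc•e_{ρ′})_β) · q¹_sym,(ρ′,w)(β′,x′) ∕ 2`. -/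
theorem tsum_symHessKerAt_col (ρ' : Fin (3 + 1)) (w x' : Fin (3 + 1) → ℤ) (β β' : Fin (3 + 1)) :
    ∑' x, symHessKerAt (ctr 4 Lc) Lc ρ' w (β, x) (β', x')
      = (((x' β : ℤ) : ℝ) + (((x' + unitVec β') β : ℤ) : ℝ) - ((((Lc : ℤ) • w + ctr 4 Lc) β : ℤ) : ℝ)
          - ((((Lc : ℤ) • w + ctr 4 Lc + (Lc : ℤ) • unitVec ρ') β : ℤ) : ℝ)) * symLinKerAt (ctr 4 Lc) Lc ρ' w (β', x') / 2 := by
  have h := tsum_dz_mul_symHessFFAt (one_le_of_neZero Lc) (ctrOff_mem_box (one_le_of_neZero Lc)) ρ' w x' β'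
    (fun z : Fin (3 + 1) → ℤ => ((z β : ℤ) : ℝ))
  have hpt : ∀ x : Fin (3 + 1) → ℤ,
      ∑ α, dz (fun z : Fin (3 + 1) → ℤ => ((z β : ℤ) : ℝ)) α x * symHessFFAt (toSite (ctrOff (3 + 1) Lc)) Lc ρ' w x x' (Sum.inl α) (Sum.inl β')
        = symHessKerAt (ctr 4 Lc) Lc ρ' w (β, x) (β', x') := by
    intro x
    rw [Finset.sum_eq_single β]
    · rw [dz_coord, if_pos rfl, one_mul, symHessFFAt_inl_inl]; rfl
    · intro α _ hα
      rw [dz_coord, if_neg hα, zero_mul]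
    · exact fun h => absurd (Finset.mem_univ β) h
  simp only [hpt] at h
  rw [h]
  rfl

/-! ## §3 The letter charge of the residual vanishes at the Λ-lock (centred root, `Lc` odd) -/

section Charge

/-- [folklore] SUPPORT of `h_sym` in its first slot (box root `ρ_c`): zero unless `x ∈ nearBox Lc w`. -/
theorem symHessKerAt_eq_zero_of_not_mem_left (ρ' : Fin (3 + 1)) (w : Fin (3 + 1) → ℤ) {x : Fin (3 + 1) → ℤ} (hx : x ∉ nearBox Lc w)
    (β β' : Fin (3 + 1)) (x' : Fin (3 + 1) → ℤ) : symHessKerAt (ctr 4 Lc) Lc ρ' w (β, x) (β', x') = 0 :=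
  symHessKerAt_eq_zero_left (ctrOff_mem_box (one_le_of_neZero Lc)) (f := (β, x)) (fun h => hx (mem_nearBox.2 h)) _

/-- [folklore] SUPPORT of `h_sym` in its second slot. -/
theorem symHessKerAt_eq_zero_of_not_mem_right (ρ' : Fin (3 + 1)) (w : Fin (3 + 1) → ℤ) (β : Fin (3 + 1)) (x : Fin (3 + 1) → ℤ) (β' : Fin (3 + 1))
    {x' : Fin (3 + 1) → ℤ} (hx' : x' ∉ nearBox Lc w) : symHessKerAt (ctr 4 Lc) Lc ρ' w (β, x) (β', x') = 0 :=
  symHessKerAt_eq_zero_right (ctrOff_mem_box (one_le_of_neZero Lc)) _ (f' := (β', x')) (fun h => hx' (mem_nearBox.2 h))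

/-- [folklore] SUPPORT of `q¹_sym` (box root `ρ_c`): zero off `nearBox Lc w`. -/
theorem symLinKerAt_ctr_eq_zero_of_not_mem (ρ' : Fin (3 + 1)) (w : Fin (3 + 1) → ℤ) {x : Fin (3 + 1) → ℤ} (hx : x ∉ nearBox Lc w)
    (α : Fin (3 + 1)) : symLinKerAt (ctr 4 Lc) Lc ρ' w (α, x) = 0 :=
  symLinKerAt_eq_zero_of_not_mem (ctrOff_mem_box (one_le_of_neZero Lc)) ρ' hx α

/-- [folklore] SUPPORT of the residual's entries (every `cΛ`, every fibre index): zero off `nearBox Lc w × nearBox Lc w`. -/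
theorem symRWof_eq_zero_of_not_mem (cΛ : ℝ) (y : Fin (3 + 1) → ℤ) (ρ' : Fin (3 + 1)) (w : Fin (3 + 1) → ℤ)
    {xz : (Fin (3 + 1) → ℤ) × (Fin (3 + 1) → ℤ)} (hxz : xz ∉ nearBox Lc w ×ˢ nearBox Lc w) (a b : Fib 3) :
    symRWof Lc cΛ y ρ' w xz.1 xz.2 a b = 0 := by
  rw [Finset.mem_product, not_and_or] at hxz
  rcases a with β | m <;> rcases b with β' | m'
  · rw [symRWof_inl_inl_eq]
    rcases hxz with h1 | h2
    · rw [symHessKerAt_eq_zero_of_not_mem_left ρ' w h1, zero_mul]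
    · rw [symHessKerAt_eq_zero_of_not_mem_right ρ' w β xz.1 β' h2, zero_mul]
  · rw [symRWof_apply, symWardM_inl_inr, symDatM_inl_inr, sub_zero]
  · rw [symRWof_apply, symWardM_inr, symDatM_inr, sub_zero]
  · rw [symRWof_apply, symWardM_inr, symDatM_inr, sub_zero]

/-- [folklore] Hence the residual's pair-charge integrand is summable (finitely supported), every `cΛ`. -/
theorem summable_prod_symRWof (cΛ : ℝ) (y : Fin (3 + 1) → ℤ) (ρ' : Fin (3 + 1)) (w : Fin (3 + 1) → ℤ) (a b : Fib 3) :
    Summable fun xz : (Fin (3 + 1) → ℤ) × (Fin (3 + 1) → ℤ) => symRWof Lc cΛ y ρ' w xz.1 xz.2 a b :=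
  summable_of_ne_finset_zero (s := nearBox Lc w ×ˢ nearBox Lc w) fun _ hxz => symRWof_eq_zero_of_not_mem cΛ y ρ' w hxz a b

/-- NOT IN PRINT; OUR BOOKKEEPING ((S-β), field–field channels).  **THE LETTER CHARGE OF an1's MIXED WARD RESIDUAL VANISHES IN EVERY FIELD–FIELD CHANNEL**
(centred root, `Lc` odd, Λ-lock `cΛ·Lc⁴ = 2`; every label `y`, multiplier leg `(ρ′, w)`, channel `(β, β′)`):
`Σ'_{(x,x′)} symRWof Lc cΛ y ρ′ w x x′ (inl β) (inl β′) = 0`.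
Proof: §1's lock entry formula `cΛ·h·(𝟙[w=y] − ½𝟙_B(x) − ½𝟙_B(x′))`; the pair sum is finite (`nearBox × nearBox`); the `x′`-sum of the first two weights is a
ROW sum of `h`, the `x`-sum of the third a COLUMN sum (§2), so the charge is `cΛ·(−½𝟙[w=y]·S₁ + ¼·S₂ − ¼·S₃)` with `S₁ = Σ'_x W_{β′}(β,x)q¹(β,x)`,
`S₂ = Σ'_x 𝟙_B(x)W_{β′}(β,x)q¹(β,x)`, `S₃ = Σ'_x 𝟙_B(x)W_β(β′,x)q¹(β′,x)`; on the diagonal `S₁ = 0` (PART 1a, exactness) and `S₂ = S₃` literally; off the diagonal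
all three vanish (PART 1b, transverse block reflection). -/
theorem tsum_prod_symRWof_inl_inl (hodd : Odd Lc) {cΛ : ℝ} (hΛ : cΛ * (Lc : ℝ) ^ 4 = 2) (y : Fin (3 + 1) → ℤ) (ρ' : Fin (3 + 1))
    (w : Fin (3 + 1) → ℤ) (β β' : Fin (3 + 1)) :
    ∑' xz : (Fin (3 + 1) → ℤ) × (Fin (3 + 1) → ℤ), symRWof Lc cΛ y ρ' w xz.1 xz.2 (Sum.inl β) (Sum.inl β') = 0 := by
  classical
  -- the letters of the computation
  set nb : Finset (Fin (3 + 1) → ℤ) := nearBox Lc w with hnb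
  set B : (Fin (3 + 1) → ℤ) → ℝ := fun z => if blk Lc z = y then (1 : ℝ) else 0 with hB
  set c0 : ℝ := if w = y then (1 : ℝ) else 0 with hc0
  set hK : (Fin (3 + 1) → ℤ) → (Fin (3 + 1) → ℤ) → ℝ := fun x x' => symHessKerAt (ctr 4 Lc) Lc ρ' w (β, x) (β', x') with hhK
  set q : Fin (3 + 1) → (Fin (3 + 1) → ℤ) → ℝ := fun α x => symLinKerAt (ctr 4 Lc) Lc ρ' w (α, x) with hq
  set W : Fin (3 + 1) → Fin (3 + 1) → (Fin (3 + 1) → ℤ) → ℝ := fun lam α x =>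
    ((x lam : ℤ) : ℝ) + (((x + unitVec α) lam : ℤ) : ℝ) - ((((Lc : ℤ) • w + ctr 4 Lc) lam : ℤ) : ℝ)
      - ((((Lc : ℤ) • w + ctr 4 Lc + (Lc : ℤ) • unitVec ρ') lam : ℤ) : ℝ) with hW
  -- §1: the entries at the lock
  have hE : ∀ xz : (Fin (3 + 1) → ℤ) × (Fin (3 + 1) → ℤ),
      symRWof Lc cΛ y ρ' w xz.1 xz.2 (Sum.inl β) (Sum.inl β')
        = (cΛ * (c0 - (1 / 2 : ℝ) * B xz.1)) * hK xz.1 xz.2 + (-(cΛ / 2) * B xz.2) * hK xz.1 xz.2 := by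
    intro xz
    rw [symRWof_inl_inl_lock hΛ]
    ring
  rw [tsum_congr hE]
  -- finite support
  have hz : ∀ xz ∉ nb ×ˢ nb, (cΛ * (c0 - (1 / 2 : ℝ) * B xz.1)) * hK xz.1 xz.2 + (-(cΛ / 2) * B xz.2) * hK xz.1 xz.2 = 0 := by
    intro xz hxz
    have h0 : hK xz.1 xz.2 = 0 := by
      rw [Finset.mem_product, not_and_or] at hxz
      rcases hxz with h1 | h2
      · exact symHessKerAt_eq_zero_of_not_mem_left ρ' w h1 β β' xz.2
      · exact symHessKerAt_eq_zero_of_not_mem_right ρ' w β xz.1 β' h2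
    rw [h0, mul_zero, mul_zero, add_zero]
  rw [tsum_eq_sum hz, Finset.sum_product, Finset.sum_congr rfl fun x _ => Finset.sum_add_distrib, Finset.sum_add_distrib]
  -- §2: row and column sums
  have hrow : ∀ x, ∑ x' ∈ nb, hK x x' = -(W β' β x * q β x / 2) := by
    intro x
    have e : ∑' x', hK x x' = ∑ x' ∈ nb, hK x x' :=
      tsum_eq_sum fun x' hx' => symHessKerAt_eq_zero_of_not_mem_right ρ' w β x β' hx'
    rw [← e]
    exact tsum_symHessKerAt_row ρ' w x β β'
  have hcol : ∀ x', ∑ x ∈ nb, hK x x' = W β β' x' * q β' x' / 2 := by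
    intro x'
    have e : ∑' x, hK x x' = ∑ x ∈ nb, hK x x' :=
      tsum_eq_sum (f := fun x => hK x x') fun x hx => symHessKerAt_eq_zero_of_not_mem_left ρ' w hx β β' x'
    rw [← e]
    exact tsum_symHessKerAt_col ρ' w x' β β'
  have h1 : ∑ x ∈ nb, ∑ x' ∈ nb, (cΛ * (c0 - (1 / 2 : ℝ) * B x)) * hK x x'
      = -(cΛ * c0 / 2) * ∑ x ∈ nb, W β' β x * q β x + (cΛ / 4) * ∑ x ∈ nb, B x * (W β' β x * q β x) := by
    rw [Finset.mul_sum, Finset.mul_sum, ← Finset.sum_add_distrib]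
    refine Finset.sum_congr rfl fun x _ => ?_
    rw [← Finset.mul_sum, hrow x]
    ring
  have h2 : ∑ x ∈ nb, ∑ x' ∈ nb, (-(cΛ / 2) * B x') * hK x x' = -(cΛ / 4) * ∑ x' ∈ nb, B x' * (W β β' x' * q β' x') := by
    rw [Finset.sum_comm, Finset.mul_sum]
    refine Finset.sum_congr rfl fun x' _ => ?_
    rw [← Finset.mul_sum, hcol x']
    ring
  rw [h1, h2]
  -- the three first-order sums as `tsum`s
  have hS : ∀ (F : (Fin (3 + 1) → ℤ) → ℝ) (lam α : Fin (3 + 1)),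
      ∑ x ∈ nb, F x * (W lam α x * q α x) = ∑' x, F x * (W lam α x * q α x) := by
    intro F lam α
    have e : ∑' x, F x * (W lam α x * q α x) = ∑ x ∈ nb, F x * (W lam α x * q α x) :=
      tsum_eq_sum (f := fun x => F x * (W lam α x * q α x)) fun x hx => by
        show F x * (W lam α x * symLinKerAt (ctr 4 Lc) Lc ρ' w (α, x)) = 0
        rw [symLinKerAt_ctr_eq_zero_of_not_mem ρ' w hx α, mul_zero, mul_zero]
    exact e.symm
  have hS1 : ∑ x ∈ nb, W β' β x * q β x = 0 := by
    have e : ∑ x ∈ nb, W β' β x * q β x = ∑ x ∈ nb, (1 : ℝ) * (W β' β x * q β x) := Finset.sum_congr rfl fun x _ => (one_mul _).symm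
    rw [e, hS]
    simp only [one_mul]
    rcases eq_or_ne β β' with hββ | hββ
    · subst hββ
      exact tsum_coordWeight_mul_symLinKerAt_diag (one_le_of_neZero Lc) (ctrOff_mem_box (one_le_of_neZero Lc)) ρ' β w
    · exact tsum_coordWeight_mul_symLinKerAt_eq_zero (d := 3) hodd ρ' w hββ
  rw [hS1, mul_zero, zero_add]
  rcases eq_or_ne β β' with hββ | hββ
  · subst hββ
    ring
  · have hS2 : ∑ x ∈ nb, B x * (W β' β x * q β x) = 0 := by
      rw [hS]
      have h := tsum_blk_coordWeight_mul_symLinKerAt_eq_zero (d := 3) hodd ρ' w y hββ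
      simpa only [mul_assoc] using h
    have hS3 : ∑ x' ∈ nb, B x' * (W β β' x' * q β' x') = 0 := by
      rw [hS]
      have h := tsum_blk_coordWeight_mul_symLinKerAt_eq_zero (d := 3) hodd ρ' w y (Ne.symm hββ)
      simpa only [mul_assoc] using h
    rw [hS2, hS3]
    ring

/-- NOT IN PRINT; OUR BOOKKEEPING.  **(S-β) AT LEVEL 0, EVERY FIBRE INDEX**: `Σ'_{(x,x′)} symRWof Lc cΛ y ρ′ w x x′ a b = 0` (the mixed ∕ multiplier blocks of the
residual are zero entrywise). -/
theorem tsum_prod_symRWof (hodd : Odd Lc) {cΛ : ℝ} (hΛ : cΛ * (Lc : ℝ) ^ 4 = 2) (y : Fin (3 + 1) → ℤ) (ρ' : Fin (3 + 1)) (w : Fin (3 + 1) → ℤ)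
    (a b : Fib 3) : ∑' xz : (Fin (3 + 1) → ℤ) × (Fin (3 + 1) → ℤ), symRWof Lc cΛ y ρ' w xz.1 xz.2 a b = 0 := by
  rcases a with β | m <;> rcases b with β' | m'
  · exact tsum_prod_symRWof_inl_inl hodd hΛ y ρ' w β β'
  · simp only [symRWof_apply, symWardM_inl_inr, symDatM_inl_inr, sub_zero, tsum_zero]
  · simp only [symRWof_apply, symWardM_inr, symDatM_inr, sub_zero, tsum_zero]
  · simp only [symRWof_apply, symWardM_inr, symDatM_inr, sub_zero, tsum_zero]

/-- NOT IN PRINT; OUR BOOKKEEPING.  **(S-β) — an1's MIXED WARD REMAINDER `symRMAn1 Lc cΛ` IS CHARGE-FREE PER LETTER, EVERY LEVEL** (centred root, `Lc` odd,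
Λ-lock `cΛ·Lc⁴ = 2`; every `j y ρ′ w a b`): `Σ'_{(x,x′)} symRMAn1 Lc cΛ j y ρ′ w x x′ a b = 0` — the OWNER gan24-p1 g27's R14 (5) ∕ R15 (x) (engine E18 ∕ E20:
162∕162 resp. 81∕81 letters) as a theorem, in p2's letter-charge currency of `WardResidualRotatedVertex.hasSum_prod_vertexOfM`. -/
theorem tsum_prod_symRMAn1_eq_zero (hodd : Odd Lc) {cΛ : ℝ} (hΛ : cΛ * (Lc : ℝ) ^ 4 = 2) (j : ℕ) (y : Fin (3 + 1) → ℤ) (ρ' : Fin (3 + 1))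
    (w : Fin (3 + 1) → ℤ) (a b : Fib 3) :
    ∑' xz : (Fin (3 + 1) → ℤ) × (Fin (3 + 1) → ℤ), symRMAn1 Lc cΛ j y ρ' w xz.1 xz.2 a b = 0 := by
  simp only [symRMAn1, Pi.smul_apply, smul_eq_mul]
  rw [tsum_mul_left, tsum_prod_symRWof hodd hΛ, mul_zero]

/-- NOT IN PRINT; OUR BOOKKEEPING.  The same as a `HasSum` (the integrand is finitely supported). -/
theorem hasSum_prod_symRMAn1 (hodd : Odd Lc) {cΛ : ℝ} (hΛ : cΛ * (Lc : ℝ) ^ 4 = 2) (j : ℕ) (y : Fin (3 + 1) → ℤ) (ρ' : Fin (3 + 1))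
    (w : Fin (3 + 1) → ℤ) (a b : Fib 3) :
    HasSum (fun xz : (Fin (3 + 1) → ℤ) × (Fin (3 + 1) → ℤ) => symRMAn1 Lc cΛ j y ρ' w xz.1 xz.2 a b) 0 := by
  have hs : Summable fun xz : (Fin (3 + 1) → ℤ) × (Fin (3 + 1) → ℤ) => symRMAn1 Lc cΛ j y ρ' w xz.1 xz.2 a b := by
    have h := (summable_prod_symRWof (Lc := Lc) cΛ y ρ' w a b).mul_left (BalabanStepW2.wM1 3 Lc j)
    refine h.congr fun xz => ?_
    simp only [symRMAn1, Pi.smul_apply, smul_eq_mul]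
  rw [← tsum_prod_symRMAn1_eq_zero hodd hΛ j y ρ' w a b]
  exact hs.hasSum

end Charge

/-! ## §4 The (β)-piece of the level-(j+1) first-order data has identically vanishing plain charge profile -/

section BetaPiece

/-- NOT IN PRINT; OUR BOOKKEEPING.  **THE (β)-PIECE DROPS OUT OF THE (S) ROW**: through ANY kernel `G` whose multiplier columns decay on the coarse scale
(e.g. `G_{j+1} = coDressKBmAt ρ_c Lc (KInvStep Lc (j+1))`), for every slot `(ν, y′)`, label `y`, level `j` and channel `(a, b)`,
`HasSum ((x,z) ↦ vertexOfM G Lc (symRMAn1 Lc cΛ j y) ν y′ x z a b) 0` — p2's value form `hasSum_prod_vertexOfM` with every letter charge zero (§3).  So the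
plain charge profile of the (β)-piece is identically zero: its (M0) ∕ (Π) hold with all moments `0`, with no symmetry ((INV)) and no W-Z0 needed. -/
theorem hasSum_prod_vertexOfM_symRMAn1 (hodd : Odd Lc) {cΛ : ℝ} (hΛ : cΛ * (Lc : ℝ) ^ 4 = 2) {G : MKer (3 + 1) (Fib 3)} {C' m : ℝ}
    {c₀ : Site (3 + 1)} (ν : Fin (3 + 1)) (y' : Site (3 + 1))
    (hw : ∀ (ρ : Fin (3 + 1)) (w : Site (3 + 1)), |colM G Lc ν y' ρ w| ≤ C' * Real.exp (-m * l1 ((Lc : ℤ) • w - c₀))) (hm : 0 < m)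
    (j : ℕ) (y : Fin (3 + 1) → ℤ) (a b : Fib 3) :
    HasSum (fun xz : Site (3 + 1) × Site (3 + 1) => vertexOfM G Lc (symRMAn1 Lc cΛ j y) ν y' xz.1 xz.2 a b) 0 := by
  obtain ⟨C, δ, hδ, hV⟩ := vertexFamily_symRMAn1 (Lc := Lc) (one_le_of_neZero Lc) cΛ j
  have h := hasSum_prod_vertexOfM (N := Lc) ν y' hw hm (hV y) hδ a b
  simp only [tsum_prod_symRMAn1_eq_zero hodd hΛ, mul_zero, tsum_zero, Finset.sum_const_zero] at h
  exact h

/-- NOT IN PRINT; OUR BOOKKEEPING.  The same in `tsum` form: the PLAIN CHARGE PROFILE of the (β)-piece is the zero function of the slot `(ν, y′)` — so its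
mass (M0) and all its slot-moments (Π) vanish trivially, whatever the weight. -/
theorem tsum_prod_vertexOfM_symRMAn1 (hodd : Odd Lc) {cΛ : ℝ} (hΛ : cΛ * (Lc : ℝ) ^ 4 = 2) {G : MKer (3 + 1) (Fib 3)} {C' m : ℝ}
    {c₀ : Site (3 + 1)} (ν : Fin (3 + 1)) (y' : Site (3 + 1))
    (hw : ∀ (ρ : Fin (3 + 1)) (w : Site (3 + 1)), |colM G Lc ν y' ρ w| ≤ C' * Real.exp (-m * l1 ((Lc : ℤ) • w - c₀))) (hm : 0 < m)
    (j : ℕ) (y : Fin (3 + 1) → ℤ) (a b : Fib 3) :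
    ∑' xz : Site (3 + 1) × Site (3 + 1), vertexOfM G Lc (symRMAn1 Lc cΛ j y) ν y' xz.1 xz.2 a b = 0 :=
  (hasSum_prod_vertexOfM_symRMAn1 hodd hΛ ν y' hw hm j y a b).tsum_eq

/-- NOT IN PRINT; OUR BOOKKEEPING.  **THE COMB INSTANCE, HYPOTHESIS-FREE**: through the tower's own dressed one-step kernel `G = coDressKBmAt ρ_c Lc (KInvStep Lc j′)`
(ANY level `j′`; its multiplier columns decay by an2's `decays_coDressKBmAt_KInvStep` ∕ `abs_colM_le`), the (β)-piece `vertexOfM G Lc (symRMAn1 Lc cΛ j y) ν y′` has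
ZERO plain charge at every slot `(ν, y′)`, every label `y`, every channel — the (β)-letter of `WardResidualSRecursion.divW_WrecAt_succ_vertexForm` (there `j′ = j+1`
and `RM = symRMAn1 Lc cΛ (j+1)` by an1's `hM₂_sym`) contributes NOTHING to the (S) row. -/
theorem hasSum_prod_vertexOfM_symRMAn1_comb (hodd : Odd Lc) {cΛ : ℝ} (hΛ : cΛ * (Lc : ℝ) ^ 4 = 2) (j' j : ℕ) (y : Fin (3 + 1) → ℤ)
    (ν : Fin (3 + 1)) (y' : Site (3 + 1)) (a b : Fib 3) :
    HasSum (fun xz : Site (3 + 1) × Site (3 + 1) =>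
      vertexOfM (coDressKBmAt (ctr 4 Lc) Lc (KInvStep (d := 3) Lc j')) Lc (symRMAn1 Lc cΛ j y) ν y' xz.1 xz.2 a b) 0 := by
  obtain ⟨δG, CG, hδG, -, hG⟩ := decays_coDressKBmAt_KInvStep (d := 3) (ctrOff_mem_box (one_le_of_neZero Lc)) j'
  exact hasSum_prod_vertexOfM_symRMAn1 hodd hΛ ν y' (fun ρ w => abs_colM_le (N := Lc) hG ν y' ρ w) hδG j y a b

end BetaPiece

end Summit.QuantumFields.BalabanUV.Beta.GAN24.SymRMChargeFree

end
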